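import Mathlib

/-!
# Transport of private lines — the homogeneous (single-orbit) criterion
(stub `stub_tangencySets`, crux `LevelOneGL2Designs`, stmt-MatrixMultiplication-14080; wall-breaker axis 3/12)

The structural fact behind every *homogeneous* (orbit) construction of a strong representative
system: invertible linear maps of `(ZMod p)²` permute the origin-avoiding lines `{y | y ⬝ᵥ b = 1}`
(`b ↦ (g⁻¹)ᵀ b`), so a private line at one point of a linearly homogeneous point set is transported
to a private line at every point.  Hence

  **a point set on which a group of invertible matrices acts transitively is a tangency set as
  soon as ONE origin-avoiding line meets it in exactly one point** (`srs_of_transitive`),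

in the normal form of the stub and without loss of size.  This is the typed form of §B of the axis
note (AXIS.md): by Dickson, over a prime field the only such groups of order `≥ p^{3/2}/C` are
torus-type, and the one-secant condition becomes a statement about cyclotomic numbers.
Elementary; valid over `ZMod p` for every `p`.
-/

set_option linter.dupNamespace false -- `MatrixMultiplication.MatrixMultiplication` (summit = problem, D-0017)

open Finset Matrix

namespace Summit.MatrixMultiplication.MatrixMultiplication.Theorems.LevelOneGL2Designs.FlagLine

section Transport

variable {p : ℕ}

/-- Pairing against a transported line: `x ⬝ᵥ ((g⁻¹)ᵀ *ᵥ b) = (g⁻¹ *ᵥ x) ⬝ᵥ b`. [elementary] -/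
theorem dotProduct_transpose_inv_mulVec (g : Matrix (Fin 2) (Fin 2) (ZMod p)) (x b : Fin 2 → ZMod p) :
    x ⬝ᵥ (g⁻¹.transpose *ᵥ b) = (g⁻¹ *ᵥ x) ⬝ᵥ b := by
  rw [dotProduct_mulVec, vecMul_transpose]

/-- **Transport of private lines / the homogeneous criterion.**  Let `T ⊆ (ZMod p)²` be a point
set and `x₀` a point with a PRIVATE origin-avoiding line `{y | y ⬝ᵥ b₀ = 1}` (through `x₀`,
meeting `T` in no other point; `x₀ ∈ T` is not even needed), and suppose every `x ∈ T` is the image of `x₀` under some invertible matrix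
mapping `T` into itself.  Then `T` carries a normal-form strong representative system with exactly
`#T` flags: the flag at `g x₀` is `(g x₀, (g⁻¹)ᵀ b₀)`. [elementary] -/
theorem srs_of_transitive (T : Finset (Fin 2 → ZMod p)) (x₀ : Fin 2 → ZMod p)
    (b₀ : Fin 2 → ZMod p) (h₀ : x₀ ⬝ᵥ b₀ = 1) (hpriv : ∀ y ∈ T, y ⬝ᵥ b₀ = 1 → y = x₀)
    (htrans : ∀ x ∈ T, ∃ g : Matrix (Fin 2) (Fin 2) (ZMod p),
      IsUnit g.det ∧ g *ᵥ x₀ = x ∧ ∀ y ∈ T, g *ᵥ y ∈ T) :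
    ∃ S : Finset ((Fin 2 → ZMod p) × (Fin 2 → ZMod p)),
      S.card = T.card ∧ ∀ f ∈ S, ∀ f' ∈ S, (dotProduct f.1 f'.2 = 1 ↔ f = f') := by
  classical
  -- choose a transporting matrix for every point of `T`
  choose! g hg using htrans
  -- the flag map
  let Φ : (Fin 2 → ZMod p) → (Fin 2 → ZMod p) × (Fin 2 → ZMod p) :=
    fun x => (x, (g x)⁻¹.transpose *ᵥ b₀)
  have hΦinj : Set.InjOn Φ T := fun x _ y _ h => congrArg Prod.fst h
  -- key computation: for `x, x' ∈ T`, `x ⬝ᵥ (flag line of x') = ((g x')⁻¹ x) ⬝ᵥ b₀`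
  -- and `(g x')⁻¹` maps `T` onto `T` (inverse of a bijection of a finite set)
  have hsurj : ∀ x' ∈ T, ∀ y ∈ T, ∃ z ∈ T, g x' *ᵥ z = y := by
    intro x' hx' y hy
    have hmaps : Set.MapsTo (fun z => g x' *ᵥ z) T T := fun z hz => (hg x' hx').2.2 z hz
    have hinj : Set.InjOn (fun z => g x' *ᵥ z) T := by
      intro z _ w _ hzw
      have := congrArg (fun v => (g x')⁻¹ *ᵥ v) hzw
      simpa only [mulVec_mulVec, nonsing_inv_mul _ (hg x' hx').1, one_mulVec] using this
    have hbij : Set.BijOn (fun z => g x' *ᵥ z) T T := by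
      refine ⟨hmaps, hinj, ?_⟩
      exact Finset.surjOn_of_injOn_of_card_le _ hmaps hinj le_rfl
    obtain ⟨z, hz, hzy⟩ := hbij.2.2 hy
    exact ⟨z, hz, hzy⟩
  refine ⟨T.image Φ, card_image_of_injOn hΦinj, ?_⟩
  intro f hf f' hf'
  rw [mem_image] at hf hf'
  obtain ⟨x, hx, rfl⟩ := hf
  obtain ⟨x', hx', rfl⟩ := hf'
  have hdet' := (hg x' hx').1
  constructor
  · intro h1
    -- `((g x')⁻¹ x) ⬝ᵥ b₀ = 1`, and `(g x')⁻¹ x ∈ T`, so it is `x₀`, so `x = g x' x₀ = x'`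
    have h2 : ((g x')⁻¹ *ᵥ x) ⬝ᵥ b₀ = 1 := by
      rw [← dotProduct_transpose_inv_mulVec]; exact h1
    obtain ⟨z, hz, hzx⟩ := hsurj x' hx' x hx
    have hz' : (g x')⁻¹ *ᵥ x = z := by
      rw [← hzx, mulVec_mulVec, nonsing_inv_mul _ hdet', one_mulVec]
    rw [hz'] at h2
    have hzx₀ : z = x₀ := hpriv z hz h2
    have hxx' : x = x' := by rw [← hzx, hzx₀, (hg x' hx').2.1]
    subst hxx'
    rfl
  · intro h
    have hxx' : x = x' := congrArg Prod.fst h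
    subst hxx'
    show x ⬝ᵥ ((g x)⁻¹.transpose *ᵥ b₀) = 1
    have hinv : (g x)⁻¹ *ᵥ x = x₀ := by
      have e : (g x)⁻¹ *ᵥ (g x *ᵥ x₀) = x₀ := by
        rw [mulVec_mulVec, nonsing_inv_mul _ (hg x hx).1, one_mulVec]
      rw [(hg x hx).2.1] at e
      exact e
    rw [dotProduct_transpose_inv_mulVec, hinv, h₀]

end Transport

end Summit.MatrixMultiplication.MatrixMultiplication.Theorems.LevelOneGL2Designs.FlagLine
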